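/-
Copyright: the b2b-balaban cell (near-miss cell 7), T⁴-continuum fan-out, lineage t4-ne7b-p3 (node U5c LARGE-DEVIATION
member P3).  Released under the licence of the surrounding project.
-/
import Mathlib.Combinatorics.SimpleGraph.Connectivity.Subgraph
import Summits.QuantumFields.BalabanUV.T4Continuum.Support.SpaceTimePeierlsLeaves

/-!
# Space-time Peierls ∕ Cramér route for NE7b — leaf A2c: THE CONTOUR COVER FROM A VERTICAL CHAIN OF OCCUPIED CELLS
# (persistence forces volume — the deterministic half of the Cramér step, skeleton row ST4)

Summits-side support leaf of the T⁴-continuum cell (rung (B)+1 on a FINITE torus only; NOT infinite volume, NOT the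
mass gap, NOT the Clay statement; NOT a proof of the spine estimate NE7b).  Lineage `t4-ne7b-p3` (generation 2), node
U5c, skeleton `t4/skeletons/NE7b-t4-ne7b-p3.md` leaf A2c, row ST4.  [folklore] finite graph combinatorics over the
abstract occupancy model `SpaceTimePeierlsLeaves.OccModel`; nothing is quoted from print and nothing printed is
asserted; no `[cite:]` tag.

WHAT.  Leaf A2c (`OccModel.ContourCover M Bad jlo K`: every bad term has a CONTOUR — a connected component of its
occupied cell set — meeting every scale of the window `[jlo, K]`) is reduced to the rawest form of the occupancy reading
A2b: «a structure live at the final scale `K` and born at a scale `≤ jlo` occupies, at every scale `u ∈ [jlo, K]`, a cell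
`c u`, and `c (u+1)` is adjacent to `c u`» (vertical nesting through the parent relation).
* §1 `exists_contour_of_connected`: the connected component of the occupied set containing a nonempty connected occupied
  set `S` is a contour containing `S` (component = the cells joined to `S` by a walk INSIDE the occupied set; connected
  by `SimpleGraph.induce_connected_of_patches`; maximal by extending a walk by one edge);
* §2 `contourCover_of_connected`: bad terms with a connected occupied set meeting every scale of `[jlo, K]` ⇒
  `ContourCover`; `contourCover_of_chains`: bad terms with a VERTICAL CHAIN of occupied cells `c jlo ~ c (jlo+1) ~ ⋯ ~
  c K`, `scale (c u) = u` ⇒ `ContourCover` (the chain is connected: a walk along it).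
So the `cover` field of `SpaceTimeAssembly.LineageReadings` costs exactly the chain reading; nothing of Bałaban's is
asserted.

HONEST DEPENDENCY (cell, verbatim): continuum YM on T⁴ ⇐ BetaPertH ∧ nine spine estimates (0/9 proved); BetaPertH ⇐
(D1) ∧ (D4) ∧ CAP+tail; G-an2-4 gates asym, D1 and NE2/3/4.  This file changes none of it.
-/

open Finset

namespace Summit.QuantumFields.BalabanUV.T4Continuum.SpaceTimePeierlsLeaves

variable {ι Cell : Type*}

/-! ## §1 The component of the occupied set through a connected occupied set is a contour -/

section Component

/-- `M.OccWalk τ c₀ c`: there is a walk of the space-time adjacency from `c₀` to `c` all of whose cells are occupied by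
the term `τ` (reachability INSIDE the occupied set). [folklore] -/
def OccModel.OccWalk (M : OccModel ι Cell) (τ : ι) (c₀ c : Cell) : Prop :=
  ∃ p : M.Adj.Walk c₀ c, ∀ x ∈ p.support, x ∈ M.Occ τ

/-- reachability inside the occupied set is reflexive at an occupied cell [folklore] -/
theorem OccModel.occWalk_refl (M : OccModel ι Cell) {τ : ι} {c₀ : Cell} (h : c₀ ∈ M.Occ τ) : M.OccWalk τ c₀ c₀ :=
  ⟨SimpleGraph.Walk.nil, fun x hx => by
    rw [SimpleGraph.Walk.support_nil, List.mem_singleton] at hx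
    exact hx ▸ h⟩

/-- … extends along an edge into an occupied cell [folklore] -/
theorem OccModel.occWalk_adj (M : OccModel ι Cell) {τ : ι} {c₀ c c' : Cell} (h : M.OccWalk τ c₀ c)
    (hadj : M.Adj.Adj c c') (hc' : c' ∈ M.Occ τ) : M.OccWalk τ c₀ c' := by
  obtain ⟨p, hp⟩ := h
  refine ⟨p.concat hadj, fun x hx => ?_⟩
  simp only [SimpleGraph.Walk.support_concat, List.mem_append, List.mem_singleton] at hx
  rcases hx with hx | rfl
  · exact hp x hx
  · exact hc'

/-- … and passes to every cell on the way [folklore] -/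
theorem OccModel.occWalk_of_mem_support (M : OccModel ι Cell) [DecidableEq Cell] {τ : ι} {c₀ c : Cell}
    {p : M.Adj.Walk c₀ c} (hp : ∀ x ∈ p.support, x ∈ M.Occ τ) {x : Cell} (hx : x ∈ p.support) :
    M.OccWalk τ c₀ x :=
  ⟨p.takeUntil x hx, fun y hy => hp y (p.support_takeUntil_subset_support hx hy)⟩

/-- **THE COMPONENT THROUGH A CONNECTED OCCUPIED SET IS A CONTOUR.**  If `S ⊆ Occ τ` is nonempty and connected in the
space-time adjacency, then the cells of `Occ τ` joined to `S` by walks inside `Occ τ` form a contour of `τ`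
(`IsContour`: inside the occupied set, nonempty, connected, and no occupied cell outside it touches it) containing `S`.
[folklore] -/
theorem OccModel.exists_contour_of_connected (M : OccModel ι Cell) [DecidableEq Cell] {τ : ι} {S : Finset Cell}
    (hS : S ⊆ M.Occ τ) (hne : S.Nonempty) (hconn : (M.Adj.induce (S : Set Cell)).Connected) :
    ∃ 𝒦, M.IsContour τ 𝒦 ∧ S ⊆ 𝒦 := by
  classical
  obtain ⟨c₀, hc₀⟩ := hne
  have hc₀O : c₀ ∈ M.Occ τ := hS hc₀
  -- the component: occupied cells reachable inside the occupied set
  let 𝒦 : Finset Cell := (M.Occ τ).filter fun c => M.OccWalk τ c₀ c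
  have hmem : ∀ {c}, c ∈ 𝒦 ↔ c ∈ M.Occ τ ∧ M.OccWalk τ c₀ c := fun {c} => by
    simp only [𝒦, mem_filter]
  have hc₀𝒦 : c₀ ∈ 𝒦 := hmem.2 ⟨hc₀O, M.occWalk_refl hc₀O⟩
  -- `S ⊆ 𝒦`: a walk inside `S` is a walk inside the occupied set (induction along the walk)
  have hS𝒦 : S ⊆ 𝒦 := by
    have key : ∀ {a b : (S : Set Cell)} (p : (M.Adj.induce (S : Set Cell)).Walk a b),
        M.OccWalk τ c₀ a → M.OccWalk τ c₀ b := by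
      intro a b p
      induction p with
      | nil => exact id
      | cons h q ih => exact fun ha => ih (M.occWalk_adj ha h (hS (mem_coe.1 (Subtype.prop _))))
    intro c hc
    obtain ⟨p⟩ := hconn.preconnected ⟨c₀, mem_coe.2 hc₀⟩ ⟨c, mem_coe.2 hc⟩
    exact hmem.2 ⟨hS hc, key p (M.occWalk_refl hc₀O)⟩
  refine ⟨𝒦, ⟨fun c hc => (hmem.1 hc).1, ⟨c₀, hc₀𝒦⟩, ?_, ?_⟩, hS𝒦⟩
  · -- connected: patch every cell of the component to `c₀` by the support of its walk
    refine M.Adj.induce_connected_of_patches c₀ (mem_coe.2 hc₀𝒦) ?_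
    intro v hv
    obtain ⟨hvO, p, hp⟩ := hmem.1 (mem_coe.1 hv)
    refine ⟨{x | x ∈ p.support}, fun x hx => ?_, p.start_mem_support, p.end_mem_support, ?_⟩
    · exact mem_coe.2 (hmem.2 ⟨hp x hx, M.occWalk_of_mem_support hp hx⟩)
    · exact (p.connected_induce_support).preconnected _ _
  · -- maximal: an occupied neighbour of the component is in the component
    intro c hcO hc𝒦 c' hc' hadj
    exact hc𝒦 (hmem.2 ⟨hcO, M.occWalk_adj (hmem.1 hc').2 hadj.symm hcO⟩)

end Component

/-! ## §2 The cover from connected occupied sets and from vertical chains -/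

section Cover

/-- **A2c FROM CONNECTED OCCUPIED SETS**: if every bad term (bad terms being terms) has a nonempty connected occupied
set meeting every scale of `[jlo, K]`, then `ContourCover M Bad jlo K`. [folklore] -/
theorem OccModel.contourCover_of_connected (M : OccModel ι Cell) [DecidableEq Cell] {Bad : Finset ι} {jlo K : ℕ}
    (hBad : Bad ⊆ M.T)
    (h : ∀ τ ∈ Bad, ∃ S : Finset Cell, S ⊆ M.Occ τ ∧ S.Nonempty ∧ (M.Adj.induce (S : Set Cell)).Connected ∧
      ∀ u ∈ Icc jlo K, ∃ c ∈ S, M.scale c = u) :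
    M.ContourCover Bad jlo K := by
  refine ⟨hBad, fun τ hτ => ?_⟩
  obtain ⟨S, hS, hne, hconn, hmeet⟩ := h τ hτ
  obtain ⟨𝒦, h𝒦, hS𝒦⟩ := M.exists_contour_of_connected hS hne hconn
  exact ⟨𝒦, h𝒦, fun u hu => by
    obtain ⟨c, hc, hcu⟩ := hmeet u hu
    exact ⟨c, hS𝒦 hc, hcu⟩⟩

/-- Along a chain `c jlo ~ c (jlo+1) ~ ⋯` of occupied cells there is a walk from `c jlo` to `c (jlo + m)` whose cells
are chain cells of index `≤ jlo + m`. [folklore] -/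
theorem OccModel.exists_walk_of_chain (M : OccModel ι Cell) {c : ℕ → Cell} {jlo K : ℕ}
    (hadj : ∀ u, jlo ≤ u → u < K → M.Adj.Adj (c u) (c (u + 1))) :
    ∀ m, jlo + m ≤ K → ∃ p : M.Adj.Walk (c jlo) (c (jlo + m)),
      ∀ x ∈ p.support, ∃ u, jlo ≤ u ∧ u ≤ jlo + m ∧ x = c u
  | 0, _ => ⟨SimpleGraph.Walk.nil, fun x hx => by
      rw [SimpleGraph.Walk.support_nil, List.mem_singleton] at hx
      exact ⟨jlo, le_rfl, by omega, by simpa using hx⟩⟩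
  | m + 1, hm => by
      obtain ⟨p, hp⟩ := M.exists_walk_of_chain hadj m (by omega)
      have ha : M.Adj.Adj (c (jlo + m)) (c (jlo + m + 1)) := hadj (jlo + m) (by omega) (by omega)
      refine ⟨(p.concat ha).copy rfl (by rw [Nat.add_assoc]), fun x hx => ?_⟩
      simp only [SimpleGraph.Walk.support_copy, SimpleGraph.Walk.support_concat,
        List.mem_append, List.mem_singleton] at hx
      rcases hx with hx | rfl
      · obtain ⟨u, hu1, hu2, rfl⟩ := hp x hx
        exact ⟨u, hu1, by omega, rfl⟩
      · exact ⟨jlo + m + 1, by omega, by omega, rfl⟩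

/-- **A2c FROM VERTICAL CHAINS — PERSISTENCE FORCES VOLUME.**  If every bad term occupies, at every scale `u` of the
window `[jlo, K]`, a cell `c u` of scale `u`, consecutive ones adjacent (the parent relation of the nesting reading),
then `ContourCover M Bad jlo K`: the chain is a connected occupied set meeting every scale, and the component through
it is the contour. [folklore] -/
theorem OccModel.contourCover_of_chains (M : OccModel ι Cell) [DecidableEq Cell] {Bad : Finset ι} {jlo K : ℕ}
    (hBad : Bad ⊆ M.T) (hjlo : jlo ≤ K)
    (h : ∀ τ ∈ Bad, ∃ c : ℕ → Cell, (∀ u, jlo ≤ u → u ≤ K → c u ∈ M.Occ τ ∧ M.scale (c u) = u) ∧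
      (∀ u, jlo ≤ u → u < K → M.Adj.Adj (c u) (c (u + 1)))) :
    M.ContourCover Bad jlo K := by
  classical
  refine M.contourCover_of_connected hBad fun τ hτ => ?_
  obtain ⟨c, hocc, hadj⟩ := h τ hτ
  let S : Finset Cell := (Icc jlo K).image c
  have hSmem : ∀ {x}, x ∈ S ↔ ∃ u, jlo ≤ u ∧ u ≤ K ∧ x = c u := fun {x} => by
    simp only [S, mem_image, mem_Icc]
    constructor
    · rintro ⟨u, ⟨h1, h2⟩, rfl⟩; exact ⟨u, h1, h2, rfl⟩
    · rintro ⟨u, h1, h2, rfl⟩; exact ⟨u, ⟨h1, h2⟩, rfl⟩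
  have hc0 : c jlo ∈ S := hSmem.2 ⟨jlo, le_rfl, hjlo, rfl⟩
  refine ⟨S, fun x hx => ?_, ⟨c jlo, hc0⟩, ?_, fun u hu => ?_⟩
  · obtain ⟨u, h1, h2, rfl⟩ := hSmem.1 hx
    exact (hocc u h1 h2).1
  · -- connected: patch `c u` to `c jlo` by the walk along the chain
    refine M.Adj.induce_connected_of_patches (c jlo) (mem_coe.2 hc0) ?_
    intro v hv
    obtain ⟨u, h1, h2, rfl⟩ := hSmem.1 (mem_coe.1 hv)
    obtain ⟨p, hp⟩ := M.exists_walk_of_chain hadj (u - jlo) (by omega)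
    have hend : c (jlo + (u - jlo)) = c u := by rw [Nat.add_sub_cancel' h1]
    refine ⟨{x | x ∈ p.support}, fun x hx => ?_, p.start_mem_support, ?_, ?_⟩
    · obtain ⟨w, hw1, hw2, rfl⟩ := hp x hx
      exact mem_coe.2 (hSmem.2 ⟨w, hw1, by omega, rfl⟩)
    · rw [← hend]; exact p.end_mem_support
    · exact (p.connected_induce_support).preconnected _ _
  · rw [mem_Icc] at hu
    exact ⟨c u, hSmem.2 ⟨u, hu.1, hu.2, rfl⟩, (hocc u hu.1 hu.2).2⟩

end Cover

end Summit.QuantumFields.BalabanUV.T4Continuum.SpaceTimePeierlsLeaves
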